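import Mathlib
import HarnessLib
import Literature.NumberTheory.Transcendental.KZProductIdeal
import Summits.KontsevichZagierPeriods.KontsevichZagierPeriods.Theses.LinRedNormalForm

/-!
# Coordinate reversal of cubical atoms

Groundwork for crux `DihedralNormalForm` (stmt-KontsevichZagierPeriods-3912), line
`torus-descent-sum-shadow`, stub `stub_nonSimpleReduction`. The coordinate reversal `x ↦ x ∘ rev`
of the open cube is a KZ relation (`KZ.IntegralRep.reindex` along `Fin.revPerm`,
`KZ.of_sub_of_reindex_mem_relations`) between the atom `[□ᵏ, q·xᵃ·∏_{i≤j}(1 - x_i⋯x_j)^{e i j}]` and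
the atom with reversed data `a ∘ rev`, `e' i j = e (rev j) (rev i)`. Together with the dihedral
reflection (`dihedralReflection`, files `…StubNonSimpleReductionAux1–5`) it generates the dihedral group
`D_{k+3}` of Brown's polygon acting on cubical atoms (the rotation by one step is reflection ∘ reversal).
-/

noncomputable section

namespace Summit.KontsevichZagierPeriods.DihedralNormalForm.TorusDescent

open Finset Set MeasureTheory
open Literature.NumberTheory.Transcendental

/-- The atom integrand at the reversed point is the reversed atom integrand. -/
theorem atom_comp_rev {k : ℕ} (q : ℚ) (a : Fin k → ℕ) (e : Fin k → Fin k → ℤ) (w : Fin k → ℝ) :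
    (q : ℝ) * ((∏ i : Fin k, (w (Fin.rev i)) ^ a i) * ∏ i : Fin k, ∏ j : Fin k, if i ≤ j then
        (1 - (∏ l : Fin k, if i ≤ l ∧ l ≤ j then w (Fin.rev l) else 1)) ^ e i j else 1) =
      (q : ℝ) * ((∏ i : Fin k, w i ^ a (Fin.rev i)) * ∏ i : Fin k, ∏ j : Fin k, if i ≤ j then
        (1 - (∏ l : Fin k, if i ≤ l ∧ l ≤ j then w l else 1)) ^ e (Fin.rev j) (Fin.rev i) else 1) := by
  congr 2
  · -- monomial part: reindex by `rev`
    rw [← Equiv.prod_comp Fin.revPerm (fun i => w i ^ a (Fin.rev i))]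
    exact Finset.prod_congr rfl fun i _ => by simp [Fin.revPerm_apply, Fin.rev_rev]
  · -- chord part: inner products first
    have hinner : ∀ i j : Fin k, (∏ l : Fin k, if i ≤ l ∧ l ≤ j then w (Fin.rev l) else 1) =
        ∏ l : Fin k, if Fin.rev j ≤ l ∧ l ≤ Fin.rev i then w l else 1 := by
      intro i j
      rw [← Equiv.prod_comp Fin.revPerm (fun l => if Fin.rev j ≤ l ∧ l ≤ Fin.rev i then w l else 1)]
      refine Finset.prod_congr rfl fun l _ => ?_
      simp only [Fin.revPerm_apply]
      have : (Fin.rev j ≤ Fin.rev l ∧ Fin.rev l ≤ Fin.rev i) ↔ (i ≤ l ∧ l ≤ j) := by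
        rw [Fin.rev_le_rev, Fin.rev_le_rev]; exact and_comm
      rw [if_congr this rfl rfl]
    simp_rw [hinner]
    -- reindex the double product by `(i, j) ↦ (rev j, rev i)`
    rw [Finset.prod_comm]
    rw [← Equiv.prod_comp Fin.revPerm (fun j => ∏ i : Fin k, if i ≤ j then
        (1 - ∏ l : Fin k, if Fin.rev j ≤ l ∧ l ≤ Fin.rev i then w l else 1) ^ e i j else 1)]
    refine Finset.prod_congr rfl fun j _ => ?_
    rw [← Equiv.prod_comp Fin.revPerm (fun i => if i ≤ Fin.revPerm j then
        (1 - ∏ l : Fin k, if Fin.rev (Fin.revPerm j) ≤ l ∧ l ≤ Fin.rev i then w l else 1) ^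
          e i (Fin.revPerm j) else 1)]
    refine Finset.prod_congr rfl fun i _ => ?_
    simp only [Fin.revPerm_apply, Fin.rev_rev, Fin.rev_le_rev]

/-- **Coordinate reversal of cubical atoms** (one `KZ.permRel`-type move): the atom
`[□ᵏ, q·xᵃ·∏_{i≤j}(1 - x_i⋯x_j)^{e i j}]` is congruent modulo `KZ.relations` to the atom with the
reversed data `a' = a ∘ rev`, `e' i j = e (rev j) (rev i)`. -/
theorem atomReversal : ∀ (k : ℕ) (q : ℚ) (a : Fin k → ℕ) (e : Fin k → Fin k → ℤ) (s : Literature.NumberTheory.Transcendental.KZ.IntegralRep k), s.domain = {x : Fin k → ℝ | ∀ i, x i ∈ Set.Ioo (0:ℝ) 1} → Set.EqOn s.integrand (fun x => (q : ℝ) * ((∏ i : Fin k, x i ^ a i) * ∏ i : Fin k, ∏ j : Fin k, if i ≤ j then (1 - (∏ l : Fin k, if i ≤ l ∧ l ≤ j then x l else 1)) ^ e i j else 1)) s.domain → ∃ s' : Literature.NumberTheory.Transcendental.KZ.IntegralRep k, s'.domain = {x : Fin k → ℝ | ∀ i, x i ∈ Set.Ioo (0:ℝ) 1} ∧ Set.EqOn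 s'.integrand (fun x => (q : ℝ) * ((∏ i : Fin k, x i ^ a (Fin.rev i)) * ∏ i : Fin k, ∏ j : Fin k, if i ≤ j then (1 - (∏ l : Fin k, if i ≤ l ∧ l ≤ j then x l else 1)) ^ e (Fin.rev j) (Fin.rev i) else 1)) s'.domain ∧ Literature.NumberTheory.Transcendental.KZ.of s - Literature.NumberTheory.Transcendental.KZ.of s' ∈ Literature.NumberTheory.Transcendental.KZ.relations := by
  intro k q a e s hdom hint
  refine ⟨s.reindex Fin.revPerm, ?_, ?_, KZ.of_sub_of_reindex_mem_relations s Fin.revPerm⟩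
  · rw [KZ.IntegralRep.reindex_domain, hdom]
    ext w
    simp only [Set.mem_setOf_eq, Fin.revPerm_apply]
    constructor
    · intro h i; simpa [Fin.rev_rev] using h (Fin.rev i)
    · intro h i; exact h (Fin.rev i)
  · intro w hw
    rw [KZ.IntegralRep.reindex_domain] at hw
    rw [KZ.IntegralRep.reindex_integrand]
    have hw' : (fun i => w (Fin.revPerm i)) ∈ s.domain := hw
    show s.integrand (fun i => w (Fin.revPerm i)) = _
    rw [hint hw']
    simp only [Fin.revPerm_apply]
    exact atom_comp_rev q a e w

end Summit.KontsevichZagierPeriods.DihedralNormalForm.TorusDescent
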